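import Summits.CriticalPhenomena.PercolationContinuityZ3.Theorems.PercNearOneGluingNoHeavyLowerTailKnQuestion8CoefficientwiseCoreClassKernelMixReducedKleitman

/-!
# The reduced Kleitman inequality (N), II: the single thread and general bundles

A thread of length `ℓ` is the cube `{R,B}^ℓ` (`R = true > B = false`) with `c` = letterwise
negation, `r` = "replace the first letter of the full word `R^ℓ` by `B`" (identity elsewhere) and
valid families = decreasing, not containing `R^ℓ`, and red→dark twin-closed
(`R^a B τ ∈ W → B^a R τ ∈ W`).  We build it by appending letters (`NThread.succ`: the new
last letter is the outer `Bool` factor, the twin closure becomes fibrewise closure plus the top twin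
`(⊤,B) ∈ W → (⊥,R) ∈ W`) and prove the **thread step** `isNSpace_threadSucc`: (N) survives
appending a letter (Case A: both letter-fibres of `W` valid — induction twice and the
`ρ`-rearrangement; Case B: `R^{ℓ}B ∈ W` — induction on the `R`-fibre and a pointwise count
using `c ⊤ = ⊥` and `r = id` off `⊤`).  With Part I this gives (N) on every product of threads
and free coordinates (`NBundle.isNSpace_ofShape`), i.e. the ND4 Hall inequality for every bundle and all
threads simultaneously.
-/

namespace Summit.CriticalPhenomena.PercolationContinuityZ3.Theorems.Coefficientwise.ReducedKleitman

open Finset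

variable {X Y : Type*}

section ThreadLike

variable [PartialOrder X] [BoundedOrder X]

/-- A thread-like space: the complement of the full word is the empty word, and the reduction
moves only the full word. -/
structure ThreadLike (c r : X → X) : Prop where
  /-- `c ⊤ = ⊥` -/
  c_top : c ⊤ = ⊥
  /-- `r` fixes every point except `⊤` -/
  r_of_ne_top : ∀ x, x ≠ ⊤ → r x = x

/-- In a thread-like space `r x ≤ x`. -/
theorem ThreadLike.r_le {c r : X → X} (h : ThreadLike c r) (x : X) : r x ≤ x := by
  by_cases hx : x = ⊤
  · rw [hx]; exact le_top
  · rw [h.r_of_ne_top x hx]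

/-- The complementation map after appending a last letter. -/
def succC (c : X → X) (p : X × Bool) : X × Bool := (c p.1, !p.2)

/-- The reduction after appending a last letter (the full word is `(⊤, true)`). -/
def succR (r : X → X) (p : X × Bool) : X × Bool := (if p.2 then r p.1 else p.1, p.2)

/-- The top of `X × Bool`. -/
theorem top_prod_bool : (⊤ : X × Bool) = (⊤, true) := rfl

/-- The bottom of `X × Bool`. -/
theorem bot_prod_bool : (⊥ : X × Bool) = (⊥, false) := rfl

/-- Appending a letter preserves thread-likeness. -/
theorem threadLike_succ {c r : X → X} (h : ThreadLike c r) : ThreadLike (succC c) (succR r) := by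
  constructor
  · rw [top_prod_bool, bot_prod_bool, succC, h.c_top]; rfl
  · rintro ⟨x, b⟩ hne
    cases b
    · simp [succR]
    · have hx : x ≠ ⊤ := by
        rintro rfl; exact hne (by rw [top_prod_bool])
      simp [succR, h.r_of_ne_top x hx]

omit [BoundedOrder X] in
/-- `succR r p ≤ p` when `r x ≤ x` for all `x`. -/
theorem succR_le {r : X → X} (hr : ∀ x, r x ≤ x) (p : X × Bool) : succR r p ≤ p := by
  obtain ⟨x, b⟩ := p
  cases b
  · simp [succR]
  · simpa [succR, Prod.mk_le_mk] using hr x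

end ThreadLike

section Thread

variable [Fintype X] [DecidableEq X] [PartialOrder X] [BoundedOrder X]

/-- Thread validity: decreasing, without the full word `⊤`, and `TC` (the twin closure). -/
def ThreadValid (TC : Finset X → Prop) (W : Finset X) : Prop :=
  IsLowerSet (W : Set X) ∧ ⊤ ∉ W ∧ TC W

/-- Twin closure after appending a last letter: fibrewise in the old letters, plus the top twin
`R^{ℓ}B ∈ W → B^{ℓ}R ∈ W`, i.e. `(⊤,false) ∈ W → (⊥,true) ∈ W`. -/
def succTC (TC : Finset X → Prop) (W : Finset (X × Bool)) : Prop :=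
  (∀ b, TC (fibR W b)) ∧ ((⊤, false) ∈ W → (⊥, true) ∈ W)

/-- **Thread step.** If a thread-like space satisfies (N) for `ThreadValid TC`, then after
appending a last letter it satisfies (N) for `ThreadValid (succTC TC)`. -/
theorem isNSpace_threadSucc {c r : X → X} {TC : Finset X → Prop} (hT : ThreadLike c r)
    (hN : IsNSpace c r (ThreadValid TC)) :
    IsNSpace (succC c) (succR r) (ThreadValid (succTC TC)) := by
  intro U W hU hW
  obtain ⟨hWlow, hWtop, hTC, htwin⟩ := hW
  have hU01 : fibR U false ⊆ fibR U true := fun x hx => by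
    rw [mem_fibR] at hx ⊢
    exact hU (show (x, false) ≤ (x, true) from Prod.mk_le_mk.2 ⟨le_rfl, Bool.false_le _⟩) hx
  have hW10 : fibR W true ⊆ fibR W false := fun x hx => by
    rw [mem_fibR] at hx ⊢
    exact hWlow (show (x, false) ≤ (x, true) from Prod.mk_le_mk.2 ⟨le_rfl, Bool.false_le _⟩)
      hx
  have hUup : ∀ b, IsUpperSet (fibR U b : Set X) := fun b x x' hxx' hx => by
    rw [mem_coe, mem_fibR] at hx ⊢
    exact hU (show (x, b) ≤ (x', b) from Prod.mk_le_mk.2 ⟨hxx', le_rfl⟩) hx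
  have hWlow' : ∀ b, IsLowerSet (fibR W b : Set X) := fun b x x' hxx' hx => by
    rw [mem_coe, mem_fibR] at hx ⊢
    exact hWlow (show (x', b) ≤ (x, b) from Prod.mk_le_mk.2 ⟨hxx', le_rfl⟩) hx
  have htopW1 : ⊤ ∉ fibR W true := fun h => by
    rw [mem_fibR, ← top_prod_bool] at h; exact hWtop h
  -- the two sides, fibrewise
  have eL : (U ∩ W).card =
      (fibR U true ∩ fibR W true).card + (fibR U false ∩ fibR W false).card := by
    rw [card_eq_sum_card_fibR (U ∩ W), Fintype.sum_bool]
    congr 1 <;> (congr 1; ext x; simp [mem_fibR])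
  have eR : (rho (succC c) (succR r) U W).card =
      (rho c r (fibR U true) (fibR W false)).card +
        ((fibR U false).filter (fun x => c x ∈ fibR W true)).card := by
    rw [card_eq_sum_card_fibR (rho (succC c) (succR r) U W), Fintype.sum_bool]
    congr 1
    · congr 1; ext x
      simp only [mem_fibR, mem_rho, succC, succR, Bool.not_true, if_true]
    · congr 1; ext x
      simp only [mem_fibR, mem_rho, mem_filter, succC, succR, Bool.not_false, Bool.false_eq_true,
        if_false]
      tauto
  rw [eL, eR]
  by_cases htop : ⊤ ∈ fibR W false
  · -- Case B: the `false` fibre of `W` is everything and `⊥` lies in the `true` fibre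
    have hall : ∀ x, x ∈ fibR W false := fun x => hWlow' false (le_top : x ≤ ⊤) htop
    have hbot : ⊥ ∈ fibR W true := by
      rw [mem_fibR]; apply htwin; rw [mem_fibR] at htop; exact htop
    have IH := hN (fibR U true) (fibR W true) (hUup true) ⟨hWlow' true, htopW1, hTC true⟩
    have e0 : fibR U false ∩ fibR W false = fibR U false := by
      ext x; simp [mem_inter, hall x]
    rw [e0]
    have key : (fibR U false).card + (rho c r (fibR U true) (fibR W true)).card ≤
        (rho c r (fibR U true) (fibR W false)).card +
          ((fibR U false).filter (fun x => c x ∈ fibR W true)).card := by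
      rw [card_eq_sum_ite (fibR U false), card_rho_eq_sum, card_rho_eq_sum,
        card_filter_eq_sum_ite, ← sum_add_distrib, ← sum_add_distrib]
      refine sum_le_sum (fun x _ => ?_)
      by_cases hx : x = ⊤
      · subst hx
        have hc : c ⊤ ∈ fibR W true := by rw [hT.c_top]; exact hbot
        have hc0 : c ⊤ ∈ fibR W false := hall _
        simp only [hc, hc0, and_true]
        split_ifs <;> omega
      · rw [hT.r_of_ne_top x hx]
        have hu : x ∈ fibR U false → x ∈ fibR U true := fun h => hU01 h
        have hc0 : c x ∈ fibR W false := hall _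
        split_ifs <;> simp_all
    omega
  · -- Case A: both fibres valid
    have IH₀ := hN (fibR U false) (fibR W false) (hUup false) ⟨hWlow' false, htop, hTC false⟩
    have IH₁ := hN (fibR U true) (fibR W true) (hUup true) ⟨hWlow' true, htopW1, hTC true⟩
    have hre := rho_rearrangement c r hU01 hW10
    have hmono : (rho c r (fibR U false) (fibR W true)).card ≤
        ((fibR U false).filter (fun x => c x ∈ fibR W true)).card := by
      refine card_le_card (fun x hx => ?_)
      rw [mem_rho] at hx; exact mem_filter.2 ⟨hx.1, hx.2.1⟩
    omega

end Thread

section ThreadBases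

/-- The thread of length one (`R = true`, `B = false`, `c = not`, `r ≡ B`) is thread-like. -/
theorem threadLike_bool : ThreadLike (X := Bool) (fun b => !b) (fun _ => false) := by
  constructor
  · rfl
  · intro x hx
    cases x
    · rfl
    · exact absurd rfl hx

/-- **(N) for a thread of length one.** -/
theorem isNSpace_threadOne :
    IsNSpace (X := Bool) (fun b => !b) (fun _ => false) (ThreadValid (fun _ => True)) := by
  intro U W hU hW
  obtain ⟨hWlow, htop, -⟩ := hW
  have hW' : W = ∅ ∨ W = {false} := by
    rcases lower_bool_cases W hWlow with h | h | h
    · exact Or.inl h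
    · exact Or.inr h
    · exfalso; apply htop; rw [h]; exact mem_univ _
  rcases upper_bool_cases U hU with hU' | hU' | hU' <;> rcases hW' with hW' | hW' <;>
    subst hU' hW' <;> decide

end ThreadBases

section Bundled

/-- A bundled finite thread-like space satisfying (N) (a single thread of some length). -/
structure NThread : Type 1 where
  /-- the words -/
  X : Type
  /-- finiteness -/
  [instF : Fintype X]
  /-- decidable equality -/
  [instD : DecidableEq X]
  /-- the coordinatewise order (`B < R`) -/
  [instP : PartialOrder X]
  /-- full and empty word -/
  [instB : BoundedOrder X]
  /-- complementation -/
  c : X → X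
  /-- reduction (remove the first letter of the full word) -/
  r : X → X
  /-- twin closure -/
  TC : Finset X → Prop
  /-- thread-likeness -/
  like : ThreadLike c r
  /-- the reduced Kleitman inequality -/
  isN : IsNSpace c r (ThreadValid TC)

/-- finiteness of a bundled thread -/
instance (T : NThread) : Fintype T.X := T.instF
/-- decidable equality of a bundled thread -/
instance (T : NThread) : DecidableEq T.X := T.instD
/-- the order of a bundled thread -/
instance (T : NThread) : PartialOrder T.X := T.instP
/-- top and bottom of a bundled thread -/
instance (T : NThread) : BoundedOrder T.X := T.instB

/-- The thread of length one. -/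
def NThread.one : NThread where
  X := Bool
  c := fun b => !b
  r := fun _ => false
  TC := fun _ => True
  like := threadLike_bool
  isN := isNSpace_threadOne

/-- Appending a last letter to a thread. -/
def NThread.succ (T : NThread) : NThread where
  X := T.X × Bool
  c := succC T.c
  r := succR T.r
  TC := succTC T.TC
  like := threadLike_succ T.like
  isN := isNSpace_threadSucc T.like T.isN

/-- The thread with `n + 1` letters, `{R,B}^{n+1}` with the last letter outermost. -/
def NThread.ofLen : ℕ → NThread
  | 0 => NThread.one
  | n + 1 => (NThread.ofLen n).succ

/-- **(N) for a single thread of every length.** -/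
theorem NThread.isNSpace_ofLen (n : ℕ) :
    IsNSpace (NThread.ofLen n).c (NThread.ofLen n).r (ThreadValid (NThread.ofLen n).TC) :=
  (NThread.ofLen n).isN

/-- A bundled finite preordered space with `r x ≤ x` satisfying (N). -/
structure NBundle : Type 1 where
  /-- the configurations -/
  X : Type
  /-- finiteness -/
  [instF : Fintype X]
  /-- decidable equality -/
  [instD : DecidableEq X]
  /-- the coordinatewise order -/
  [instP : Preorder X]
  /-- complementation -/
  c : X → X
  /-- reduction -/
  r : X → X
  /-- validity of a decreasing family -/
  Valid : Finset X → Prop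
  /-- the reduction only removes edges -/
  r_le : ∀ x, r x ≤ x
  /-- the reduced Kleitman inequality -/
  isN : IsNSpace c r Valid

/-- finiteness of a bundle -/
instance (B : NBundle) : Fintype B.X := B.instF
/-- decidable equality of a bundle -/
instance (B : NBundle) : DecidableEq B.X := B.instD
/-- the order of a bundle -/
instance (B : NBundle) : Preorder B.X := B.instP

/-- A thread as a bundle. -/
def NThread.toNBundle (T : NThread) : NBundle where
  X := T.X
  c := T.c
  r := T.r
  Valid := ThreadValid T.TC
  r_le := T.like.r_le
  isN := T.isN

/-- The empty bundle (one configuration). -/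
def NBundle.unit : NBundle where
  X := Unit
  c := id
  r := id
  Valid := fun _ => True
  r_le := fun _ => le_rfl
  isN := isNSpace_unit

/-- A free coordinate as a bundle. -/
def NBundle.free : NBundle where
  X := Bool
  c := fun b => !b
  r := id
  Valid := fun W => IsLowerSet (W : Set Bool)
  r_le := fun _ => le_rfl
  isN := isNSpace_free

/-- The product of two bundles (tensorization). -/
def NBundle.prod (A B : NBundle) : NBundle where
  X := A.X × B.X
  c := Prod.map A.c B.c
  r := Prod.map A.r B.r
  Valid := ProdValid A.Valid B.Valid
  r_le := fun p => Prod.mk_le_mk.2 ⟨A.r_le p.1, B.r_le p.2⟩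
  isN := isNSpace_prod B.r_le A.isN B.isN

/-- The bundle with threads of lengths `n + 1`, `n ∈ ns`, and `k` free coordinates. -/
def NBundle.ofShape : List ℕ → ℕ → NBundle
  | [], 0 => NBundle.unit
  | [], k + 1 => NBundle.free.prod (NBundle.ofShape [] k)
  | n :: ns, k => (NThread.ofLen n).toNBundle.prod (NBundle.ofShape ns k)

/-- **The reduced Kleitman inequality (N) for every bundle of threads and free coordinates.** -/
theorem NBundle.isNSpace_ofShape (ns : List ℕ) (k : ℕ) :
    IsNSpace (NBundle.ofShape ns k).c (NBundle.ofShape ns k).r (NBundle.ofShape ns k).Valid :=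
  (NBundle.ofShape ns k).isN

end Bundled

end Summit.CriticalPhenomena.PercolationContinuityZ3.Theorems.Coefficientwise.ReducedKleitman
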